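import Mathlib.Data.Real.Basic
import Mathlib.Tactic.Linarith
import Mathlib.Tactic.Positivity
import Mathlib.Tactic.Ring
import Mathlib.Tactic.NormNum
import Mathlib.Tactic.FinCases
import HarnessLib

/-!
# Kernel discharge of `StarPairFar`, part 1: exact integer enclosure arithmetic (boxes, quadratic forms)

HONEST FRAMING. Venture `Summits/Ventures/Crystal3D` (cell `crystal3d-full`), helper `--supports` the crux
`GenericWallFloor` (stmt-Ventures-19480) of `route-Ventures-StickyWulffConstant`, line `WallLedgerG`.  Rung credit only;
F-C1 not moved.  This is MILESTONE 2 (enclosure soundness) of the kernel discharge of the certified computational input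
`StarPairFar` (p603131; certified twice outside the kernel: lit g13 kit j298152–5, wulff-p2 g10 kit j298800) by a
SELF-RECOMPUTING interval branch and bound evaluated with `native_decide` (wulff-p2 g11 proposal R1; Milestone 1 =
`exists_quat_of_orthogonal_det_one`, p626276).

Contents (generic, no geometry): integer boxes in dimension four (`Box4`, quaternion charts) and three (`Box3`, the
eleventh ball), integer quadratic forms in four variables (`QF4`) with their CENTRED ENCLOSURE over a box
(`QF4.lo/hi`, `QF4.range_sound`: `P(c+δ) = P(c) + ∇P(c)·δ + P₂(δ)`, `|∇P(c)·δ| ≤ Σ|∂ₖP(c)| hₖ`, `|P₂(δ)| ≤ Σ|aₖₗ| hₖ hₗ`),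
the range of a square (`sqLo/sqHi`), the lower bound of a linear form over a box (`linLo`), the corner lower bound of
a product over a rectangle (`prodLo`), and the bisection covering lemma (`split_abs`).  Every `def` is computable over
`ℤ`; every soundness statement is over `ℝ` for REAL points of the box (the checker of the next files therefore certifies
statements about all real rotations / eleventh balls, not about grid points).
-/

namespace Summit.Ventures.Crystal3D.Theorems.StarFar

/-! ### Elementary real inequalities -/

/-- `|g·δ| ≤ |g|·h` when `|δ| ≤ h`. -/
theorem abs_mul_le_of_abs_le (g : ℝ) {δ h : ℝ} (hδ : |δ| ≤ h) : |g * δ| ≤ |g| * h := by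
  rw [abs_mul]; exact mul_le_mul_of_nonneg_left hδ (abs_nonneg g)

/-- `|a·δ·ε| ≤ |a|·h·k` when `|δ| ≤ h`, `|ε| ≤ k`. -/
theorem abs_mul_mul_le (a : ℝ) {δ ε h k : ℝ} (hδ : |δ| ≤ h) (hε : |ε| ≤ k) : |a * δ * ε| ≤ |a| * h * k := by
  rw [abs_mul, abs_mul]
  have h0 : 0 ≤ h := (abs_nonneg δ).trans hδ
  exact mul_le_mul (mul_le_mul_of_nonneg_left hδ (abs_nonneg a)) hε (abs_nonneg ε)
    (mul_nonneg (abs_nonneg a) h0)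

/-- Bisection covering: a point of `[c − 2e, c + 2e]` lies in `[c − 2e, c]` or in `[c, c + 2e]`. -/
theorem split_abs {t c e : ℝ} (h : |t - c| ≤ 2 * e) : |t - (c - e)| ≤ e ∨ |t - (c + e)| ≤ e := by
  rcases abs_le.1 h with ⟨h1, h2⟩
  rcases le_total t c with h3 | h3
  · left; rw [abs_le]; constructor <;> linarith
  · right; rw [abs_le]; constructor <;> linarith

/-! ### The range of a square -/

/-- Lower bound of `t²` over `|t − c| ≤ h`. -/
def sqLo (c h : ℤ) : ℤ :=
  if 0 < c - h then (c - h) * (c - h) else if c + h < 0 then (c + h) * (c + h) else 0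

/-- Upper bound of `t²` over `|t − c| ≤ h`. -/
def sqHi (c h : ℤ) : ℤ := max ((c - h) * (c - h)) ((c + h) * (c + h))

/-- Soundness of `sqLo`/`sqHi`. -/
theorem sq_range_sound (c h : ℤ) {t : ℝ} (ht : |t - c| ≤ h) :
    ((sqLo c h : ℤ) : ℝ) ≤ t * t ∧ t * t ≤ ((sqHi c h : ℤ) : ℝ) := by
  rcases abs_le.1 ht with ⟨h1, h2⟩
  have hp : ((c : ℝ) - h) ≤ t := by linarith
  have hq : t ≤ (c : ℝ) + h := by linarith
  constructor
  · unfold sqLo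
    split_ifs with ha hb
    · have ha' : (0 : ℝ) < (c : ℝ) - h := by exact_mod_cast ha
      push_cast; nlinarith
    · have hb' : (c : ℝ) + h < 0 := by exact_mod_cast hb
      push_cast; nlinarith
    · push_cast; nlinarith
  · unfold sqHi
    push_cast
    rcases le_total 0 t with h0 | h0
    · exact le_max_of_le_right (by nlinarith)
    · exact le_max_of_le_left (by nlinarith)

/-! ### Three-dimensional boxes (the eleventh ball) -/

/-- An integer box in `ℝ³`: centre `c`, half-widths `h` (all at the common scale of the checker). -/
structure Box3 where
  c0 : ℤ
  c1 : ℤ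
  c2 : ℤ
  h0 : ℤ
  h1 : ℤ
  h2 : ℤ

/-- Real points of a `Box3`. -/
def Box3.Mem (B : Box3) (y0 y1 y2 : ℝ) : Prop :=
  |y0 - B.c0| ≤ B.h0 ∧ |y1 - B.c1| ≤ B.h1 ∧ |y2 - B.c2| ≤ B.h2

/-- Lower bound of `Σ yₐ²` over a `Box3`. -/
def Box3.sqLo (B : Box3) : ℤ := StarFar.sqLo B.c0 B.h0 + StarFar.sqLo B.c1 B.h1 + StarFar.sqLo B.c2 B.h2

/-- Upper bound of `Σ yₐ²` over a `Box3`. -/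
def Box3.sqHi (B : Box3) : ℤ := StarFar.sqHi B.c0 B.h0 + StarFar.sqHi B.c1 B.h1 + StarFar.sqHi B.c2 B.h2

/-- Soundness of `Box3.sqLo/sqHi`. -/
theorem Box3.sq_sound (B : Box3) {y0 y1 y2 : ℝ} (hy : B.Mem y0 y1 y2) :
    ((B.sqLo : ℤ) : ℝ) ≤ y0 * y0 + y1 * y1 + y2 * y2 ∧ y0 * y0 + y1 * y1 + y2 * y2 ≤ ((B.sqHi : ℤ) : ℝ) := by
  obtain ⟨m0, m1, m2⟩ := hy
  have e0 := sq_range_sound B.c0 B.h0 m0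
  have e1 := sq_range_sound B.c1 B.h1 m1
  have e2 := sq_range_sound B.c2 B.h2 m2
  unfold Box3.sqLo Box3.sqHi
  push_cast
  constructor <;> linarith [e0.1, e0.2, e1.1, e1.2, e2.1, e2.2]

/-- Lower bound of the linear form `f ⬝ y` over a `Box3`. -/
def Box3.linLo (B : Box3) (f0 f1 f2 : ℤ) : ℤ :=
  f0 * B.c0 + f1 * B.c1 + f2 * B.c2 - (|f0| * B.h0 + |f1| * B.h1 + |f2| * B.h2)

/-- Soundness of `Box3.linLo`. -/
theorem Box3.linLo_sound (B : Box3) (f0 f1 f2 : ℤ) {y0 y1 y2 : ℝ} (hy : B.Mem y0 y1 y2) :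
    ((B.linLo f0 f1 f2 : ℤ) : ℝ) ≤ f0 * y0 + f1 * y1 + f2 * y2 := by
  obtain ⟨m0, m1, m2⟩ := hy
  have e0 := abs_le.1 (abs_mul_le_of_abs_le (f0 : ℝ) m0)
  have e1 := abs_le.1 (abs_mul_le_of_abs_le (f1 : ℝ) m1)
  have e2 := abs_le.1 (abs_mul_le_of_abs_le (f2 : ℝ) m2)
  unfold Box3.linLo
  push_cast
  nlinarith [e0.1, e1.1, e2.1]

/-- The two halves of a `Box3` along axis `a` (half-width `h/2`; exact when `h` is even). -/
def Box3.split (B : Box3) (a : Fin 3) : Box3 × Box3 :=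
  match a with
  | 0 => (⟨B.c0 - B.h0 / 2, B.c1, B.c2, B.h0 / 2, B.h1, B.h2⟩, ⟨B.c0 + B.h0 / 2, B.c1, B.c2, B.h0 / 2, B.h1, B.h2⟩)
  | 1 => (⟨B.c0, B.c1 - B.h1 / 2, B.c2, B.h0, B.h1 / 2, B.h2⟩, ⟨B.c0, B.c1 + B.h1 / 2, B.c2, B.h0, B.h1 / 2, B.h2⟩)
  | 2 => (⟨B.c0, B.c1, B.c2 - B.h2 / 2, B.h0, B.h1, B.h2 / 2⟩, ⟨B.c0, B.c1, B.c2 + B.h2 / 2, B.h0, B.h1, B.h2 / 2⟩)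

/-- The half-width along axis `a`. -/
def Box3.hw (B : Box3) (a : Fin 3) : ℤ := match a with | 0 => B.h0 | 1 => B.h1 | 2 => B.h2

/-- An even integer is twice its half (real form). -/
theorem cast_eq_two_mul_half {h : ℤ} (he : h % 2 = 0) : (h : ℝ) = 2 * ((h / 2 : ℤ) : ℝ) := by
  have : h = 2 * (h / 2) := by omega
  exact_mod_cast this

/-- Splitting covers: if the half-width along `a` is even, every point of `B` lies in one of the halves. -/
theorem Box3.split_mem (B : Box3) (a : Fin 3) (he : B.hw a % 2 = 0) {y0 y1 y2 : ℝ} (hy : B.Mem y0 y1 y2) :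
    (B.split a).1.Mem y0 y1 y2 ∨ (B.split a).2.Mem y0 y1 y2 := by
  obtain ⟨m0, m1, m2⟩ := hy
  fin_cases a
  · have h2 := cast_eq_two_mul_half (h := B.h0) he
    rw [h2] at m0
    rcases split_abs m0 with h | h
    · left; refine ⟨?_, m1, m2⟩; simp only [Box3.split]; push_cast; exact h
    · right; refine ⟨?_, m1, m2⟩; simp only [Box3.split]; push_cast; exact h
  · have h2 := cast_eq_two_mul_half (h := B.h1) he
    rw [h2] at m1
    rcases split_abs m1 with h | h
    · left; refine ⟨m0, ?_, m2⟩; simp only [Box3.split]; push_cast; exact h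
    · right; refine ⟨m0, ?_, m2⟩; simp only [Box3.split]; push_cast; exact h
  · have h2 := cast_eq_two_mul_half (h := B.h2) he
    rw [h2] at m2
    rcases split_abs m2 with h | h
    · left; refine ⟨m0, m1, ?_⟩; simp only [Box3.split]; push_cast; exact h
    · right; refine ⟨m0, m1, ?_⟩; simp only [Box3.split]; push_cast; exact h

/-! ### The corner bound of a product -/

/-- Lower bound of `v · t` for `v ∈ [lo, hi]`, `|t − c| ≤ h`: the least of the four corner products. -/
def prodLo (lo hi c h : ℤ) : ℤ :=
  min (min (lo * (c - h)) (lo * (c + h))) (min (hi * (c - h)) (hi * (c + h)))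

/-- Soundness of `prodLo` (a bilinear function attains its minimum over a rectangle at a corner). -/
theorem prodLo_sound {lo hi c h : ℤ} {v t : ℝ} (hv : (lo : ℝ) ≤ v ∧ v ≤ hi) (ht : |t - c| ≤ h) :
    ((prodLo lo hi c h : ℤ) : ℝ) ≤ v * t := by
  rcases abs_le.1 ht with ⟨h1, h2⟩
  have hp : ((c : ℝ) - h) ≤ t := by linarith
  have hq : t ≤ (c : ℝ) + h := by linarith
  unfold prodLo
  push_cast
  rcases le_total 0 t with h0 | h0
  · have hv' : (lo : ℝ) * t ≤ v * t := mul_le_mul_of_nonneg_right hv.1 h0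
    refine le_trans (min_le_left _ _) ?_
    rcases le_total 0 (lo : ℝ) with hl | hl
    · exact le_trans (min_le_left _ _) ((mul_le_mul_of_nonneg_left hp hl).trans hv')
    · exact le_trans (min_le_right _ _) ((mul_le_mul_of_nonpos_left hq hl).trans hv')
  · have hv' : (hi : ℝ) * t ≤ v * t := mul_le_mul_of_nonpos_right hv.2 h0
    refine le_trans (min_le_right _ _) ?_
    rcases le_total 0 (hi : ℝ) with hl | hl
    · exact le_trans (min_le_left _ _) ((mul_le_mul_of_nonneg_left hp hl).trans hv')
    · exact le_trans (min_le_right _ _) ((mul_le_mul_of_nonpos_left hq hl).trans hv')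

/-! ### Four-dimensional boxes (quaternion charts) and integer quadratic forms -/

/-- An integer box in `ℝ⁴`: centre `c`, half-widths `h`. -/
structure Box4 where
  c0 : ℤ
  c1 : ℤ
  c2 : ℤ
  c3 : ℤ
  h0 : ℤ
  h1 : ℤ
  h2 : ℤ
  h3 : ℤ

/-- Real points of a `Box4`. -/
def Box4.Mem (B : Box4) (x0 x1 x2 x3 : ℝ) : Prop :=
  |x0 - B.c0| ≤ B.h0 ∧ |x1 - B.c1| ≤ B.h1 ∧ |x2 - B.c2| ≤ B.h2 ∧ |x3 - B.c3| ≤ B.h3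

/-- The half-width along axis `a`. -/
def Box4.hw (B : Box4) (a : Fin 4) : ℤ := match a with | 0 => B.h0 | 1 => B.h1 | 2 => B.h2 | 3 => B.h3

/-- The two halves of a `Box4` along axis `a`. -/
def Box4.split (B : Box4) (a : Fin 4) : Box4 × Box4 :=
  match a with
  | 0 => (⟨B.c0 - B.h0 / 2, B.c1, B.c2, B.c3, B.h0 / 2, B.h1, B.h2, B.h3⟩,
          ⟨B.c0 + B.h0 / 2, B.c1, B.c2, B.c3, B.h0 / 2, B.h1, B.h2, B.h3⟩)
  | 1 => (⟨B.c0, B.c1 - B.h1 / 2, B.c2, B.c3, B.h0, B.h1 / 2, B.h2, B.h3⟩,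
          ⟨B.c0, B.c1 + B.h1 / 2, B.c2, B.c3, B.h0, B.h1 / 2, B.h2, B.h3⟩)
  | 2 => (⟨B.c0, B.c1, B.c2 - B.h2 / 2, B.c3, B.h0, B.h1, B.h2 / 2, B.h3⟩,
          ⟨B.c0, B.c1, B.c2 + B.h2 / 2, B.c3, B.h0, B.h1, B.h2 / 2, B.h3⟩)
  | 3 => (⟨B.c0, B.c1, B.c2, B.c3 - B.h3 / 2, B.h0, B.h1, B.h2, B.h3 / 2⟩,
          ⟨B.c0, B.c1, B.c2, B.c3 + B.h3 / 2, B.h0, B.h1, B.h2, B.h3 / 2⟩)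

/-- Splitting covers: if the half-width along `a` is even, every point of `B` lies in one of the halves. -/
theorem Box4.split_mem (B : Box4) (a : Fin 4) (he : B.hw a % 2 = 0) {x0 x1 x2 x3 : ℝ}
    (hx : B.Mem x0 x1 x2 x3) : (B.split a).1.Mem x0 x1 x2 x3 ∨ (B.split a).2.Mem x0 x1 x2 x3 := by
  obtain ⟨m0, m1, m2, m3⟩ := hx
  fin_cases a
  · have h2 := cast_eq_two_mul_half (h := B.h0) he
    rw [h2] at m0
    rcases split_abs m0 with h | h
    · left; refine ⟨?_, m1, m2, m3⟩; simp only [Box4.split]; push_cast; exact h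
    · right; refine ⟨?_, m1, m2, m3⟩; simp only [Box4.split]; push_cast; exact h
  · have h2 := cast_eq_two_mul_half (h := B.h1) he
    rw [h2] at m1
    rcases split_abs m1 with h | h
    · left; refine ⟨m0, ?_, m2, m3⟩; simp only [Box4.split]; push_cast; exact h
    · right; refine ⟨m0, ?_, m2, m3⟩; simp only [Box4.split]; push_cast; exact h
  · have h2 := cast_eq_two_mul_half (h := B.h2) he
    rw [h2] at m2
    rcases split_abs m2 with h | h
    · left; refine ⟨m0, m1, ?_, m3⟩; simp only [Box4.split]; push_cast; exact h
    · right; refine ⟨m0, m1, ?_, m3⟩; simp only [Box4.split]; push_cast; exact h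
  · have h2 := cast_eq_two_mul_half (h := B.h3) he
    rw [h2] at m3
    rcases split_abs m3 with h | h
    · left; refine ⟨m0, m1, m2, ?_⟩; simp only [Box4.split]; push_cast; exact h
    · right; refine ⟨m0, m1, m2, ?_⟩; simp only [Box4.split]; push_cast; exact h

/-- Lower bound of `Σ xₖ²` over a `Box4`. -/
def Box4.sqLo (B : Box4) : ℤ :=
  StarFar.sqLo B.c0 B.h0 + StarFar.sqLo B.c1 B.h1 + StarFar.sqLo B.c2 B.h2 + StarFar.sqLo B.c3 B.h3

/-- Upper bound of `Σ xₖ²` over a `Box4`. -/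
def Box4.sqHi (B : Box4) : ℤ :=
  StarFar.sqHi B.c0 B.h0 + StarFar.sqHi B.c1 B.h1 + StarFar.sqHi B.c2 B.h2 + StarFar.sqHi B.c3 B.h3

/-- Soundness of `Box4.sqLo/sqHi`. -/
theorem Box4.sq_sound (B : Box4) {x0 x1 x2 x3 : ℝ} (hx : B.Mem x0 x1 x2 x3) :
    ((B.sqLo : ℤ) : ℝ) ≤ x0 * x0 + x1 * x1 + x2 * x2 + x3 * x3 ∧
      x0 * x0 + x1 * x1 + x2 * x2 + x3 * x3 ≤ ((B.sqHi : ℤ) : ℝ) := by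
  obtain ⟨m0, m1, m2, m3⟩ := hx
  have e0 := sq_range_sound B.c0 B.h0 m0
  have e1 := sq_range_sound B.c1 B.h1 m1
  have e2 := sq_range_sound B.c2 B.h2 m2
  have e3 := sq_range_sound B.c3 B.h3 m3
  unfold Box4.sqLo Box4.sqHi
  push_cast
  constructor <;> linarith [e0.1, e0.2, e1.1, e1.2, e2.1, e2.2, e3.1, e3.2]

/-- An integer quadratic form `P(x) = Σ_{k ≤ l} aₖₗ xₖ xₗ` in four variables. -/
structure QF4 where
  a00 : ℤ
  a01 : ℤ
  a02 : ℤ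
  a03 : ℤ
  a11 : ℤ
  a12 : ℤ
  a13 : ℤ
  a22 : ℤ
  a23 : ℤ
  a33 : ℤ

namespace QF4

/-- Evaluation in a commutative ring. -/
def eval {R : Type*} [CommRing R] (P : QF4) (x0 x1 x2 x3 : R) : R :=
  (P.a00 : R) * x0 * x0 + (P.a01 : R) * x0 * x1 + (P.a02 : R) * x0 * x2 + (P.a03 : R) * x0 * x3 +
    (P.a11 : R) * x1 * x1 + (P.a12 : R) * x1 * x2 + (P.a13 : R) * x1 * x3 +
    (P.a22 : R) * x2 * x2 + (P.a23 : R) * x2 * x3 + (P.a33 : R) * x3 * x3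

/-- Sum of forms. -/
def add (P Q : QF4) : QF4 :=
  ⟨P.a00 + Q.a00, P.a01 + Q.a01, P.a02 + Q.a02, P.a03 + Q.a03, P.a11 + Q.a11, P.a12 + Q.a12,
    P.a13 + Q.a13, P.a22 + Q.a22, P.a23 + Q.a23, P.a33 + Q.a33⟩

/-- Integer multiple of a form. -/
def smul (s : ℤ) (P : QF4) : QF4 :=
  ⟨s * P.a00, s * P.a01, s * P.a02, s * P.a03, s * P.a11, s * P.a12, s * P.a13, s * P.a22, s * P.a23,
    s * P.a33⟩

/-- Difference of forms. -/
def sub (P Q : QF4) : QF4 := P.add (Q.smul (-1))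

/-- `eval` is additive. -/
theorem eval_add {R : Type*} [CommRing R] (P Q : QF4) (x0 x1 x2 x3 : R) :
    (P.add Q).eval x0 x1 x2 x3 = P.eval x0 x1 x2 x3 + Q.eval x0 x1 x2 x3 := by
  simp only [eval, add]; push_cast; ring

/-- `eval` commutes with integer multiples. -/
theorem eval_smul {R : Type*} [CommRing R] (s : ℤ) (P : QF4) (x0 x1 x2 x3 : R) :
    (P.smul s).eval x0 x1 x2 x3 = (s : R) * P.eval x0 x1 x2 x3 := by
  simp only [eval, smul]; push_cast; ring

/-- `eval` respects differences. -/
theorem eval_sub {R : Type*} [CommRing R] (P Q : QF4) (x0 x1 x2 x3 : R) :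
    (P.sub Q).eval x0 x1 x2 x3 = P.eval x0 x1 x2 x3 - Q.eval x0 x1 x2 x3 := by
  simp only [sub, eval_add, eval_smul]; push_cast; ring

/-- Integer evaluation casts to real evaluation. -/
theorem cast_eval (P : QF4) (c0 c1 c2 c3 : ℤ) :
    ((P.eval c0 c1 c2 c3 : ℤ) : ℝ) = P.eval (c0 : ℝ) (c1 : ℝ) (c2 : ℝ) (c3 : ℝ) := by
  simp only [eval]; push_cast; ring

/-- The gradient `∂₀P` at the centre of a box. -/
def g0 (P : QF4) (B : Box4) : ℤ := 2 * P.a00 * B.c0 + P.a01 * B.c1 + P.a02 * B.c2 + P.a03 * B.c3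
/-- The gradient `∂₁P` at the centre of a box. -/
def g1 (P : QF4) (B : Box4) : ℤ := P.a01 * B.c0 + 2 * P.a11 * B.c1 + P.a12 * B.c2 + P.a13 * B.c3
/-- The gradient `∂₂P` at the centre of a box. -/
def g2 (P : QF4) (B : Box4) : ℤ := P.a02 * B.c0 + P.a12 * B.c1 + 2 * P.a22 * B.c2 + P.a23 * B.c3
/-- The gradient `∂₃P` at the centre of a box. -/
def g3 (P : QF4) (B : Box4) : ℤ := P.a03 * B.c0 + P.a13 * B.c1 + P.a23 * B.c2 + 2 * P.a33 * B.c3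

/-- The radius of the centred enclosure: `Σₖ |∂ₖP(c)| hₖ + Σ_{k≤l} |aₖₗ| hₖ hₗ`. -/
def rad (P : QF4) (B : Box4) : ℤ :=
  |P.g0 B| * B.h0 + |P.g1 B| * B.h1 + |P.g2 B| * B.h2 + |P.g3 B| * B.h3 +
    (|P.a00| * B.h0 * B.h0 + |P.a01| * B.h0 * B.h1 + |P.a02| * B.h0 * B.h2 + |P.a03| * B.h0 * B.h3 +
      |P.a11| * B.h1 * B.h1 + |P.a12| * B.h1 * B.h2 + |P.a13| * B.h1 * B.h3 +
      |P.a22| * B.h2 * B.h2 + |P.a23| * B.h2 * B.h3 + |P.a33| * B.h3 * B.h3)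

/-- Lower end of the centred enclosure of `P` over `B`. -/
def lo (P : QF4) (B : Box4) : ℤ := P.eval B.c0 B.c1 B.c2 B.c3 - P.rad B

/-- Upper end of the centred enclosure of `P` over `B`. -/
def hi (P : QF4) (B : Box4) : ℤ := P.eval B.c0 B.c1 B.c2 B.c3 + P.rad B

/-- Taylor expansion of a quadratic form at the centre. -/
theorem taylor (P : QF4) (c0 c1 c2 c3 d0 d1 d2 d3 : ℝ) :
    P.eval (c0 + d0) (c1 + d1) (c2 + d2) (c3 + d3) = P.eval c0 c1 c2 c3 +
      ((2 * P.a00 * c0 + P.a01 * c1 + P.a02 * c2 + P.a03 * c3) * d0 +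
        (P.a01 * c0 + 2 * P.a11 * c1 + P.a12 * c2 + P.a13 * c3) * d1 +
        (P.a02 * c0 + P.a12 * c1 + 2 * P.a22 * c2 + P.a23 * c3) * d2 +
        (P.a03 * c0 + P.a13 * c1 + P.a23 * c2 + 2 * P.a33 * c3) * d3) +
      ((P.a00 : ℝ) * d0 * d0 + P.a01 * d0 * d1 + P.a02 * d0 * d2 + P.a03 * d0 * d3 + P.a11 * d1 * d1 +
        P.a12 * d1 * d2 + P.a13 * d1 * d3 + P.a22 * d2 * d2 + P.a23 * d2 * d3 + P.a33 * d3 * d3) := by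
  simp only [eval]; ring

/-- **Centred enclosure soundness**: `lo ≤ P(x) ≤ hi` for every REAL point `x` of the box. -/
theorem range_sound (P : QF4) (B : Box4) {x0 x1 x2 x3 : ℝ} (hx : B.Mem x0 x1 x2 x3) :
    ((P.lo B : ℤ) : ℝ) ≤ P.eval x0 x1 x2 x3 ∧ P.eval x0 x1 x2 x3 ≤ ((P.hi B : ℤ) : ℝ) := by
  obtain ⟨m0, m1, m2, m3⟩ := hx
  have key := P.taylor B.c0 B.c1 B.c2 B.c3 (x0 - B.c0) (x1 - B.c1) (x2 - B.c2) (x3 - B.c3)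
  simp only [add_sub_cancel] at key
  have l0 := abs_le.1 (abs_mul_le_of_abs_le (2 * P.a00 * B.c0 + P.a01 * B.c1 + P.a02 * B.c2 + P.a03 * B.c3 : ℝ) m0)
  have l1 := abs_le.1 (abs_mul_le_of_abs_le (P.a01 * B.c0 + 2 * P.a11 * B.c1 + P.a12 * B.c2 + P.a13 * B.c3 : ℝ) m1)
  have l2 := abs_le.1 (abs_mul_le_of_abs_le (P.a02 * B.c0 + P.a12 * B.c1 + 2 * P.a22 * B.c2 + P.a23 * B.c3 : ℝ) m2)
  have l3 := abs_le.1 (abs_mul_le_of_abs_le (P.a03 * B.c0 + P.a13 * B.c1 + P.a23 * B.c2 + 2 * P.a33 * B.c3 : ℝ) m3)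
  have q00 := abs_le.1 (abs_mul_mul_le (P.a00 : ℝ) m0 m0)
  have q01 := abs_le.1 (abs_mul_mul_le (P.a01 : ℝ) m0 m1)
  have q02 := abs_le.1 (abs_mul_mul_le (P.a02 : ℝ) m0 m2)
  have q03 := abs_le.1 (abs_mul_mul_le (P.a03 : ℝ) m0 m3)
  have q11 := abs_le.1 (abs_mul_mul_le (P.a11 : ℝ) m1 m1)
  have q12 := abs_le.1 (abs_mul_mul_le (P.a12 : ℝ) m1 m2)
  have q13 := abs_le.1 (abs_mul_mul_le (P.a13 : ℝ) m1 m3)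
  have q22 := abs_le.1 (abs_mul_mul_le (P.a22 : ℝ) m2 m2)
  have q23 := abs_le.1 (abs_mul_mul_le (P.a23 : ℝ) m2 m3)
  have q33 := abs_le.1 (abs_mul_mul_le (P.a33 : ℝ) m3 m3)
  have hc := P.cast_eval B.c0 B.c1 B.c2 B.c3
  unfold lo hi rad g0 g1 g2 g3
  rw [key]
  push_cast
  constructor <;> linarith [hc, l0.1, l0.2, l1.1, l1.2, l2.1, l2.2, l3.1, l3.2, q00.1, q00.2, q01.1, q01.2,
    q02.1, q02.2, q03.1, q03.2, q11.1, q11.2, q12.1, q12.2, q13.1, q13.2, q22.1, q22.2, q23.1, q23.2,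
    q33.1, q33.2]

end QF4

end Summit.Ventures.Crystal3D.Theorems.StarFar
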